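import Mathlib
import HarnessLib
import Summits.NavierStokesRegularity.NavierStokesRegularity.Theorems.TypeILiouvilleLambTailLogLipschitz

/-!
# TypeILiouvilleLambTailVorticityFloor — crux (L) stmt-NavierStokesRegularity-10661 `TypeIliouvilleL`:
# THE VORTICITY FLOOR OF A NON-CONSTANT BOUNDED ANCIENT FLOW IS `1/((−t) log(−t))` (part 11 of `TypeILiouvilleLambTail`)

Helper for stmt-NavierStokesRegularity-10661 (`--supports`); theorems only, no definitions, no named-fact
hypotheses; closes no item; Navier–Stokes regularity is NOT proved here (leafhand seat of the EulerZoomLiouville route).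

Class P (`‖v‖ ≤ K` on `(−∞,0) × ℝ³`, continuous, weakly divergence free, Oseen-mild), `ω = curl v`.  Part 10 gave the
log-Lipschitz dial `sup‖∇v(τ)‖ ≤ C Ω (1 + log(1/Ω))` (`Ω = sup‖ω(τ)‖ ≤ 1`); the strain ledger's stretching floor
(`TypeILiouvilleStrainLedger.const_of_eventually_stretching_le`: eventual stretching number `(−τ)‖∇v‖ ≤ a < 1` ⟹
constant) then converts it into a FLOOR FOR THE VORTICITY:

* `sqrt_mul_one_add_log_inv_le` — `√h (1 + log(1/h)) ≤ 3` on `(0,1]`;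
  `mul_one_add_log_inv_le` — for `−τ ≥ 1`, `0 < h ≤ 1`:
  `(−τ) h (1 + log(1/h)) ≤ 4 (−τ)(1 + log(−τ)) h + 3/(−τ)` (split at `h = (−τ)^{−4}`).
* `const_of_vorticity_littleO_log` — ★★★ **VORTICITY `o(1/((−t) log(−t)))` ⟹ ONE CONSTANT VECTOR**: a class-P flow with
  `‖ω(τ,x)‖ ≤ h(τ)` on a far past and `(−τ)(1 + log(−τ)) h(τ) → 0` as `τ → −∞` is constant.  Sharpens part 9
  (`β > 1`) to the logarithmic scale: equivalently, **every non-constant bounded ancient mild solution has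
  `sup_x ‖ω(τ,x)‖ ≥ c /((−τ) log(−τ))` along a sequence `τ → −∞`** for some `c = c(v) > 0`; the scale-invariant
  Type-I rate `1/(−τ)` remains open by exactly one logarithm on this axis.

HONEST LABEL: classical potential estimates; nothing here proves a registered stub, (L), or NS regularity; rung 0.
[cite: MajdaBertozziCUP2002, §3.3 Prop. 3.8, (3.87); eq. (3.80)] [cite: KochNadirashviliSereginSverak2009, §4 (i), Lemma 6.1 (arXiv:0709.3599)]
-/

noncomputable section
open MeasureTheory Filter Set Function Metric
open scoped Topology ENNReal NNReal RealInnerProductSpace Laplacian ContDiff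
open Literature.Analysis Literature.Analysis.FluidPDE Literature.Analysis.UnboundedOperators
set_option linter.dupNamespace false
namespace Summit.NavierStokesRegularity.NavierStokesRegularity.Theorems.TypeILiouvilleLambTail

/-! ## §1 Two elementary inequalities -/

/-- `√h · (1 + log(1/h)) ≤ 3` for `0 < h ≤ 1` (`u log(1/u) ≤ 1 − u` with `u = √h`). [folklore] -/
theorem sqrt_mul_one_add_log_inv_le {h : ℝ} (h0 : 0 < h) (h1 : h ≤ 1) :
    Real.sqrt h * (1 + Real.log (1 / h)) ≤ 3 := by
  have hs0 : 0 < Real.sqrt h := Real.sqrt_pos.2 h0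
  have hs1 : Real.sqrt h ≤ 1 := Real.sqrt_le_one.mpr h1
  have hlog : Real.log (1 / h) = 2 * Real.log (1 / Real.sqrt h) := by
    rw [one_div, one_div, Real.log_inv, Real.log_inv, Real.log_sqrt h0.le]; ring
  -- `u log(1/u) ≤ 1 - u ≤ 1` for `u = √h`
  have hu : Real.sqrt h * Real.log (1 / Real.sqrt h) ≤ 1 := by
    have h2 : Real.log (1 / Real.sqrt h) ≤ 1 / Real.sqrt h - 1 := Real.log_le_sub_one_of_pos (by positivity)
    calc Real.sqrt h * Real.log (1 / Real.sqrt h) ≤ Real.sqrt h * (1 / Real.sqrt h - 1) :=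
          mul_le_mul_of_nonneg_left h2 hs0.le
      _ = 1 - Real.sqrt h := by field_simp
      _ ≤ 1 := by linarith
  rw [hlog]
  nlinarith

/-- For `−τ ≥ 1` and `0 < h ≤ 1`: `(−τ) h (1 + log(1/h)) ≤ 4 (−τ)(1 + log(−τ)) h + 3/(−τ)` — if `h ≥ (−τ)^{−4}` then
`log(1/h) ≤ 4 log(−τ)`, else `(−τ) h (1 + log(1/h)) = (−τ)√h · √h(1 + log(1/h)) ≤ 3 (−τ) √h ≤ 3/(−τ)`. [folklore] -/
theorem mul_one_add_log_inv_le {s h : ℝ} (hs : 1 ≤ s) (h0 : 0 < h) (h1 : h ≤ 1) :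
    s * (h * (1 + Real.log (1 / h))) ≤ 4 * (s * (1 + Real.log s) * h) + 3 / s := by
  have hs0 : 0 < s := by linarith
  have hlogs : 0 ≤ Real.log s := Real.log_nonneg hs
  have hlogh : 0 ≤ Real.log (1 / h) := Real.log_nonneg ((one_le_div h0).2 h1)
  have hA : 0 ≤ 4 * (s * (1 + Real.log s) * h) := by positivity
  have hB : 0 ≤ 3 / s := by positivity
  rcases le_or_gt (s ^ (-(4 : ℝ))) h with hle | hlt
  · -- `log(1/h) ≤ 4 log s`
    have hl : Real.log (1 / h) ≤ 4 * Real.log s := by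
      have h2 : 1 / h ≤ s ^ (4 : ℝ) := by
        rw [div_le_iff₀ h0]
        have : s ^ (4 : ℝ) * s ^ (-(4 : ℝ)) = 1 := by
          rw [← Real.rpow_add hs0]; norm_num
        nlinarith [Real.rpow_nonneg hs0.le (4 : ℝ)]
      calc Real.log (1 / h) ≤ Real.log (s ^ (4 : ℝ)) := Real.log_le_log (by positivity) h2
        _ = 4 * Real.log s := Real.log_rpow hs0 4
    calc s * (h * (1 + Real.log (1 / h))) ≤ s * (h * (1 + 4 * Real.log s)) := by gcongr
      _ ≤ 4 * (s * (1 + Real.log s) * h) := by nlinarith [mul_nonneg hs0.le h0.le]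
      _ ≤ 4 * (s * (1 + Real.log s) * h) + 3 / s := by linarith
  · -- `h < s^{-4}`: `√h ≤ s^{-2}`
    have hsq : Real.sqrt h ≤ s ^ (-(2 : ℝ)) := by
      have h2 : Real.sqrt h ≤ Real.sqrt (s ^ (-(4 : ℝ))) := Real.sqrt_le_sqrt hlt.le
      rwa [Real.sqrt_eq_rpow (s ^ (-(4 : ℝ))), ← Real.rpow_mul hs0.le, show (-(4 : ℝ)) * (1 / 2) = -2 by norm_num]
        at h2
    have h3 := sqrt_mul_one_add_log_inv_le h0 h1
    have hkey : s * (h * (1 + Real.log (1 / h))) = s * Real.sqrt h * (Real.sqrt h * (1 + Real.log (1 / h))) := by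
      have : Real.sqrt h * Real.sqrt h = h := Real.mul_self_sqrt h0.le
      calc s * (h * (1 + Real.log (1 / h))) = s * (Real.sqrt h * Real.sqrt h) * (1 + Real.log (1 / h)) := by
            rw [this]; ring
        _ = s * Real.sqrt h * (Real.sqrt h * (1 + Real.log (1 / h))) := by ring
    have hs2 : s * s ^ (-(2 : ℝ)) = 1 / s := by
      rw [show (-(2 : ℝ)) = (-1) + (-1) by norm_num, Real.rpow_add hs0, Real.rpow_neg_one]
      field_simp
    calc s * (h * (1 + Real.log (1 / h))) = s * Real.sqrt h * (Real.sqrt h * (1 + Real.log (1 / h))) := hkey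
      _ ≤ s * s ^ (-(2 : ℝ)) * 3 :=
          mul_le_mul (mul_le_mul_of_nonneg_left hsq hs0.le) h3 (by positivity) (by positivity)
      _ = 3 / s := by rw [hs2]; ring
      _ ≤ 4 * (s * (1 + Real.log s) * h) + 3 / s := by linarith

/-! ## §2 Vorticity `o(1/((−t) log(−t)))` ⟹ one constant vector -/

/-- ★★★ **VORTICITY `o(1/((−t) log(−t)))` ⟹ ONE CONSTANT VECTOR (unconditional).**  If a class-P flow has
`‖ω(τ,x)‖ ≤ h(τ) ≤ 1` for all `x` and all `τ < T₀` (`h > 0`), and `(−τ)(1 + log(−τ)) h(τ) → 0` as `τ → −∞`, then it is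
constant: by part 10's log-Lipschitz dial and `mul_one_add_log_inv_le` the stretching number `(−τ)‖∇v(τ,x)‖` tends to
`0` uniformly in `x`, so it is eventually `≤ ½`, and the strain ledger's stretching floor
(`TypeILiouvilleStrainLedger.const_of_eventually_stretching_le`) concludes.  Contrapositive: every NON-CONSTANT bounded
ancient mild solution has `sup_x ‖ω(τ,x)‖ ≥ c/((−τ) log(−τ))` along some sequence `τ → −∞` (`c = c(v) > 0`).
[cite: MajdaBertozziCUP2002, §3.3 Prop. 3.8 (3.87), eq. (3.80)] [cite: KochNadirashviliSereginSverak2009, §4 (i) (arXiv:0709.3599)] -/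
theorem const_of_vorticity_littleO_log
    {v : ℝ → EuclideanSpace ℝ (Fin 3) → EuclideanSpace ℝ (Fin 3)}
    (hc : ContinuousOn (uncurry v) (Iio 0 ×ˢ univ))
    (hK : ∃ K : ℝ, ∀ t < 0, ∀ x, ‖v t x‖ ≤ K)
    (hd : ∀ t < 0, IsWeaklyDivFree (v t))
    (hm : ∀ s t : ℝ, s < t → t < 0 → ∀ x,
      v t x = heatExtension (v s) (t - s) x - oseenDuhamel 1 s v v t x)
    {h : ℝ → ℝ} {T₀ : ℝ} (hT₀ : T₀ < 0) (hh0 : ∀ τ < T₀, 0 < h τ) (hh1 : ∀ τ < T₀, h τ ≤ 1)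
    (hω : ∀ τ < T₀, ∀ x : EuclideanSpace ℝ (Fin 3), ‖curl (v τ) x‖ ≤ h τ)
    (hlim : Tendsto (fun τ : ℝ => (-τ) * (1 + Real.log (-τ)) * h τ) atBot (𝓝 0)) :
    ∃ b : EuclideanSpace ℝ (Fin 3), ∀ t < 0, ∀ x, v t x = b := by
  obtain ⟨C, hC0, hCv⟩ := classP_norm_fderiv_le_curl_log hc hK hd hm
  -- eventually `4 C (−τ)(1+log(−τ)) h ≤ 1/4` and `3 C/(−τ) ≤ 1/4`
  have hε : (0 : ℝ) < 1 / (4 * (4 * C + 1)) := by positivity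
  obtain ⟨T₁, hT₁⟩ := (hlim.eventually (gt_mem_nhds hε)).exists_forall_of_atBot
  set T : ℝ := min (min T₀ T₁) (-(12 * C + 1)) with hT
  have hTT₀ : T ≤ T₀ := (min_le_left _ _).trans (min_le_left _ _)
  have hTT₁ : T ≤ T₁ := (min_le_left _ _).trans (min_le_right _ _)
  have hTC : T ≤ -(12 * C + 1) := min_le_right _ _
  have hT0 : T < 0 := by have := hTC; linarith [hC0]
  refine TypeILiouvilleStrainLedger.const_of_eventually_stretching_le hc hK hd hm (a := 1 / 2) (by norm_num) hT0
    fun τ hτ x => ?_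
  have hτ0 : τ < T₀ := lt_of_lt_of_le hτ hTT₀
  have hs1 : 1 ≤ -τ := by linarith [hC0]
  have hs0 : 0 < -τ := by linarith
  have h1 := hCv τ (by linarith) (h τ) (hh0 τ hτ0) (hh1 τ hτ0) (hω τ hτ0) x
  have h2 := mul_one_add_log_inv_le hs1 (hh0 τ hτ0) (hh1 τ hτ0)
  have h3 : (-τ) * (1 + Real.log (-τ)) * h τ < 1 / (4 * (4 * C + 1)) := hT₁ τ (hτ.le.trans hTT₁)
  have h4 : 3 / (-τ) ≤ 3 / (12 * C + 1) := div_le_div_of_nonneg_left (by norm_num) (by positivity) (by linarith)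
  have hlog0 : 0 ≤ Real.log (1 / h τ) := Real.log_nonneg ((one_le_div (hh0 τ hτ0)).2 (hh1 τ hτ0))
  calc (-τ) * ‖fderiv ℝ (v τ) x‖ ≤ (-τ) * (C * h τ * (1 + Real.log (1 / h τ))) :=
        mul_le_mul_of_nonneg_left h1 hs0.le
    _ = C * ((-τ) * (h τ * (1 + Real.log (1 / h τ)))) := by ring
    _ ≤ C * (4 * ((-τ) * (1 + Real.log (-τ)) * h τ) + 3 / (-τ)) := mul_le_mul_of_nonneg_left h2 hC0
    _ ≤ C * (4 * (1 / (4 * (4 * C + 1))) + 3 / (12 * C + 1)) := by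
        refine mul_le_mul_of_nonneg_left (add_le_add ?_ h4) hC0
        linarith
    _ ≤ 1 / 2 := by
        rw [show C * (4 * (1 / (4 * (4 * C + 1))) + 3 / (12 * C + 1)) = C / (4 * C + 1) + 3 * C / (12 * C + 1) by
          field_simp]
        have i1 : C / (4 * C + 1) ≤ 1 / 4 := by rw [div_le_iff₀ (by positivity)]; linarith
        have i2 : 3 * C / (12 * C + 1) ≤ 1 / 4 := by rw [div_le_iff₀ (by positivity)]; linarith
        linarith

end Summit.NavierStokesRegularity.NavierStokesRegularity.Theorems.TypeILiouvilleLambTail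

end
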